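import Summits.Ventures.HSemireg.WedgeHankelSiegelIdealStable

/-!
# Venture HSemireg — THE SIEGEL IDEAL (5): the `(a,b)`-PLANES `x_P ∧ y_Q` (dictionary: the Dolbeault blocks `H^b(⋀^a T)` of `HT^{a+b}`)
# and their ISOTROPIC PARTS — `dim (plane(a,b) ∩ SI_{a+b}) = C(n,a)·C(n,b) − C(n,a+b)`; the powers `E_p` live in the planes `(n−p, p)`

HONEST FRAMING. Part of the Lean index of the computation cell `pub-hsemireg` (seat p10 gen 11, Sunday typer «UNIFORM-IN-n»).
Finite-dimensional EXTERIOR ALGEBRA over a field (plus polynomials in one central variable) ONLY; no variety, no cohomology theory, no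
sheaf, no Ext group, no semiregularity map; nothing here says that HC / HC_CM / HC_AV holds; no Literature fact is declared or used.
Custodian versions as in `WedgeHankelSiegelIdeal` (1/3): FORMULA-N PART A §2.6 THEOREM H / FN-4 (i) («on HT²: the Siegel space S²_Θ»),
PART A §4.1″ (the Dolbeault blocks `H^q(⋀^p T)` of `HT^k`); the dictionary (`x_a ↔ ∂_a`, `y_a ↔ dz̄_a`, so a monomial with `a` `x`-letters and
`b` `y`-letters ↔ an element of `H^b(⋀^a T)`; `⌟v` ↦ `θ ↦ θ ∧ w_n(q)`) is QUOTED, never asserted.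

THIS FILE (continues namespace `Summit.Ventures.HSemireg.Wedge.HankelSiegelIdeal`; imports (4)):
* §9 **THE `(a,b)`-PLANE** `plane n a b := span{x_P ∧ y_Q : |P| = a, |Q| = b}` (`pmon`, `plane`; the sets may meet); `linearIndependent_pmon`,
  **`finrank_plane`: `dim = C(n,a)·C(n,b)`**, `plane_le_exteriorPower`; `sym` maps the plane into `span{u_S·t^b : |S| = a+b}` (`sym_pmon_mem`,
  `finrank_tspan`), the standard monomials `r_{S,b}` lie in the plane (`rep_mem_plane`), hence **`finrank_range_symP`: `rank(sym ∣ plane(a,b))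
  = C(n,a+b)`**, `ker_symP` (= the isotropic part), and **THE ISOTROPIC PART OF EACH BLOCK: `finrank_plane_inf_siegelIdeal`:
  `dim(plane(a,b) ∩ SI_{a+b}) + C(n,a+b) = C(n,a)·C(n,b)`** — for every field, `n`, `a`, `b`; corollaries: the PURE planes (`H^0(⋀^a T)`,
  `H^b(𝒪)`) have NO isotropic part (`plane_zero_inf_siegelIdeal`, `plane_zero_inf_siegelIdeal'`), and **ON `H¹(T)` THE ISOTROPIC PART IS
  EXACTLY THE SIEGEL SPACE: `plane(1,1) ∩ SI_2 = Siegel_n`** (`plane_one_one_inf_siegelIdeal`; `n² − C(n,2) = n(n+1)/2`).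
* the powers in the planes: `mul_X_mem_plane` / `mul_Y_mem_plane`, **`w_spike_mem_plane`: `E_p = w_m(δ_p) ∈ plane(m−p, p)`** (th-7's
  recursion adds one letter per pair), and **`mul_eq_zero_of_mem_plane`: planes with more than `n` `x`-letters or `y`-letters between them
  multiply to zero** — the two ingredients of the vanishing half of the per-block rank law (sequel `…PlaneRank`).
NOT typed here: the rank of `θ ↦ θ ∧ w_n(q)` on a block (sequels (6) `…Diagonal`, (7) `…PlaneRank`); boxes; anything Ext-side.  Class side only.
-/

open Module

namespace Summit.Ventures.HSemireg.Wedge.HankelSiegelIdeal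

open Summit.Ventures.HSemireg.Wedge Summit.Ventures.HSemireg.Wedge.Hankel
  Summit.Ventures.HSemireg.Wedge.HankelSiegel

variable (K : Type*) [Field K] {n : ℕ}

/-! ## §9. The `(a,b)`-planes `x_P ∧ y_Q` (`|P| = a`, `|Q| = b`; dictionary: `H^b(⋀^a T)`) and their isotropic parts -/

/-- index of the `(a,b)`-plane monomials: an `a`-set of `x`-letters and a `b`-set of `y`-letters (the two sets may meet). -/
abbrev PIdx (n a b : ℕ) : Type := {P : Finset (Fin n) // P.card = a} × {Q : Finset (Fin n) // Q.card = b}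

/-- the plane monomial `x_P ∧ y_Q` (the basis monomial on `xs P ∪ ys Q`). -/
noncomputable def pmon {a b : ℕ} (i : PIdx n a b) : HT K (In n) := B K (In n) (xs i.1.1 ∪ ys i.2.1)

/-- **THE `(a,b)`-PLANE** `plane n a b := span{x_P ∧ y_Q : |P| = a, |Q| = b} ⊆ ⋀^{a+b} K^{2n}` (dictionary: the Dolbeault block `H^b(⋀^a T)`). -/
noncomputable def plane (n a b : ℕ) : Submodule K (HT K (In n)) := Submodule.span K (Set.range (pmon K (n := n) (a := a) (b := b)))

/-- the support `xs P ∪ ys Q` determines `P` and `Q`. -/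
lemma xs_union_ys_inj {P Q P' Q' : Finset (Fin n)} (h : xs P ∪ ys Q = xs P' ∪ ys Q') : P = P' ∧ Q = Q' := by
  constructor
  · ext c
    have h1 := congrArg (fun t => Fin.castAdd n c ∈ t) h
    simp only [Finset.mem_union, castAdd_mem_xs, eq_iff_iff] at h1
    constructor
    · intro hc; exact ((h1.mp (Or.inl hc)).resolve_right (castAdd_notMem_ys c Q'))
    · intro hc; exact ((h1.mpr (Or.inl hc)).resolve_right (castAdd_notMem_ys c Q))
  · ext c
    have h1 := congrArg (fun t => Fin.natAdd n c ∈ t) h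
    simp only [Finset.mem_union, natAdd_mem_ys, eq_iff_iff] at h1
    constructor
    · intro hc; exact ((h1.mp (Or.inr hc)).resolve_left (natAdd_notMem_xs c P'))
    · intro hc; exact ((h1.mpr (Or.inr hc)).resolve_left (natAdd_notMem_xs c P))

/-- **the plane monomials are linearly independent** (distinct basis monomials). -/
theorem linearIndependent_pmon (a b : ℕ) : LinearIndependent K (pmon K (n := n) (a := a) (b := b)) := by
  have hinj : Function.Injective (fun i : PIdx n a b => xs i.1.1 ∪ ys i.2.1) := by
    rintro ⟨⟨P, hP⟩, ⟨Q, hQ⟩⟩ ⟨⟨P', hP'⟩, ⟨Q', hQ'⟩⟩ h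
    obtain ⟨rfl, rfl⟩ := xs_union_ys_inj h
    rfl
  exact (B K (In n)).linearIndependent.comp _ hinj

/-- the number of plane monomials: `C(n,a)·C(n,b)`. -/
lemma card_PIdx (a b : ℕ) : Fintype.card (PIdx n a b) = n.choose a * n.choose b := by
  rw [Fintype.card_prod, Fintype.card_finset_len, Fintype.card_finset_len, Fintype.card_fin]

/-- **`dim plane(a,b) = C(n,a)·C(n,b)`** (`= dim H^b(⋀^a T)` in the quoted dictionary). -/
theorem finrank_plane (a b : ℕ) : finrank K (plane K n a b) = n.choose a * n.choose b := by
  rw [plane, finrank_span_eq_card (linearIndependent_pmon K a b), card_PIdx]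

/-- `plane(a,b) ⊆ ⋀^{a+b}`. -/
theorem plane_le_exteriorPower (a b : ℕ) : plane K n a b ≤ ⋀[K]^(a + b) (In n → K) := by
  rw [plane, Submodule.span_le, exteriorPower_eq_Hom_univ]
  rintro _ ⟨⟨⟨P, hP⟩, ⟨Q, hQ⟩⟩, rfl⟩
  exact B_mem_Hom K (Finset.subset_univ _) (by rw [Finset.card_union_of_disjoint (disjoint_xs_ys P Q), card_xs, card_ys, hP, hQ])

/-- the plane monomial is a non-zero multiple of `x_P · y_Q`. -/
lemma pmon_eq_smul_mul {a b : ℕ} (i : PIdx n a b) :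
    ∃ c : K, c ≠ 0 ∧ pmon K i = c • (B K (In n) (xs i.1.1) * B K (In n) (ys i.2.1)) := by
  have hu : u K (xs i.1.1) (ys i.2.1) ≠ 0 := (u_ne_zero_iff K).mpr (disjoint_xs_ys _ _)
  exact ⟨(u K (xs i.1.1) (ys i.2.1))⁻¹, inv_ne_zero hu, by rw [B_mul_B, smul_smul, inv_mul_cancel₀ hu, one_smul, pmon]⟩

/-- the target monomials of `t`-degree `b`: `u_S · t^b`, `|S| = a + b`. -/
noncomputable def tspan (n a b : ℕ) : Submodule K (SymA K n) :=
  Submodule.span K (Set.range fun S : {S : Finset (Fin n) // S.card = a + b} => Polynomial.monomial b (B K (Fin n) S.1))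

/-- `dim tspan(a,b) = C(n, a+b)`. -/
lemma finrank_tspan (a b : ℕ) : finrank K (tspan K n a b) = n.choose (a + b) := by
  have hli : LinearIndependent K (fun S : {S : Finset (Fin n) // S.card = a + b} => Polynomial.monomial b (B K (Fin n) S.1)) := by
    have h := (linearIndependent_tmon K (n := n) (a + b)).comp
      (fun S : {S : Finset (Fin n) // S.card = a + b} => ((S, ⟨b, by omega⟩) : RIdx n (a + b)))
      (fun S S' h => by simpa using congrArg Prod.fst h)
    exact h
  rw [tspan, finrank_span_eq_card hli, Fintype.card_finset_len, Fintype.card_fin]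

/-- **`sym` maps the `(a,b)`-plane into `span{u_S · t^b : |S| = a+b}`**: `sym (x_P ∧ y_Q) = c · u_{P ∪ Q} · t^b` (`0` if `P ∩ Q ≠ ∅`). -/
lemma sym_pmon_mem {a b : ℕ} (i : PIdx n a b) : sym K (pmon K i) ∈ tspan K n a b := by
  obtain ⟨⟨P, hP⟩, ⟨Q, hQ⟩⟩ := i
  obtain ⟨c, -, hc⟩ := pmon_eq_smul_mul K ((⟨P, hP⟩, ⟨Q, hQ⟩) : PIdx n a b)
  obtain ⟨c₁, -, h₁⟩ := sym_B_xs K (n := n) P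
  obtain ⟨c₂, -, h₂⟩ := sym_B_ys K (n := n) Q
  rw [hc, map_smul, map_mul, h₁, h₂, smul_mul_smul_comm, Polynomial.monomial_mul_monomial, zero_add, hQ, B_mul_B,
    ← Polynomial.smul_monomial, smul_smul]
  by_cases hPQ : Disjoint P Q
  · exact Submodule.smul_mem _ _ (Submodule.smul_mem _ _
      (Submodule.subset_span ⟨⟨P ∪ Q, by rw [Finset.card_union_of_disjoint hPQ, hP, hQ]⟩, rfl⟩))
  · rw [u_eq_zero K hPQ, zero_smul, smul_zero]
    exact Submodule.zero_mem _

/-- `sym` restricted to the `(a,b)`-plane. -/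
noncomputable def symP (n a b : ℕ) : plane K n a b →ₗ[K] SymA K n := (sym K).toLinearMap ∘ₗ (plane K n a b).subtype

/-- `sym` maps the `(a,b)`-plane into `span{u_S · t^b}`. -/
lemma sym_mem_tspan_of_mem_plane {a b : ℕ} {θ : HT K (In n)} (hθ : θ ∈ plane K n a b) : sym K θ ∈ tspan K n a b := by
  rw [plane] at hθ
  induction hθ using Submodule.span_induction with
  | mem x hx => obtain ⟨i, rfl⟩ := hx; exact sym_pmon_mem K i
  | zero => rw [map_zero]; exact Submodule.zero_mem _
  | add x y _ _ hx hy => rw [map_add]; exact Submodule.add_mem _ hx hy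
  | smul c x _ hx => rw [map_smul]; exact Submodule.smul_mem _ _ hx

/-- the range of `sym ∣ plane(a,b)` lies in `span{u_S · t^b}`. -/
lemma range_symP_le (a b : ℕ) : LinearMap.range (symP K n a b) ≤ tspan K n a b := by
  rintro _ ⟨θ, rfl⟩
  exact sym_mem_tspan_of_mem_plane K θ.2

/-- the standard monomial `r_{S,b}` (`|S| = a + b`) lies in the `(a,b)`-plane. -/
lemma rep_mem_plane {a b : ℕ} (S : {S : Finset (Fin n) // S.card = a + b}) :
    rep K ((S, ⟨b, by omega⟩) : RIdx n (a + b)) ∈ plane K n a b := by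
  obtain ⟨S, hS⟩ := S
  have hb : (canon S b).card = b := card_canon (by rw [hS]; omega)
  have ha : (S \ canon S b).card = a := by rw [Finset.card_sdiff_of_subset (canon_subset S b), hS, hb]; omega
  have : rep K ((⟨S, hS⟩, ⟨b, by omega⟩) : RIdx n (a + b)) =
      u K (xs (S \ canon S b)) (ys (canon S b)) • pmon K ((⟨S \ canon S b, ha⟩, ⟨canon S b, hb⟩) : PIdx n a b) := by
    rw [rep, B_mul_B, pmon]
  rw [this]
  exact Submodule.smul_mem _ _ (Submodule.subset_span ⟨_, rfl⟩)

/-- **`rank(sym ∣ plane(a,b)) = C(n, a+b)`.** -/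
theorem finrank_range_symP (a b : ℕ) : finrank K (LinearMap.range (symP K n a b)) = n.choose (a + b) := by
  haveI : Module.Finite K (tspan K n a b) := Module.Finite.span_of_finite K (Set.finite_range _)
  apply le_antisymm
  · rw [← finrank_tspan K (n := n) a b]
    exact Submodule.finrank_mono (range_symP_le K a b)
  · let f : {S : Finset (Fin n) // S.card = a + b} → LinearMap.range (symP K n a b) := fun S =>
      ⟨sym K (rep K ((S, ⟨b, by omega⟩) : RIdx n (a + b))), ⟨⟨_, rep_mem_plane K S⟩, rfl⟩⟩
    have hf : LinearIndependent K f := by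
      apply LinearIndependent.of_comp (LinearMap.range (symP K n a b)).subtype
      exact (linearIndependent_sym_rep K (n := n) (a + b)).comp
        (fun S : {S : Finset (Fin n) // S.card = a + b} => ((S, ⟨b, by omega⟩) : RIdx n (a + b)))
        (fun S S' h => by simpa using congrArg Prod.fst h)
    have := hf.fintype_card_le_finrank
    rwa [Fintype.card_finset_len, Fintype.card_fin] at this

/-- the kernel of `sym ∣ plane(a,b)` is the isotropic part `SI_{a+b} ∩ plane(a,b)`. -/
lemma ker_symP (a b : ℕ) : LinearMap.ker (symP K n a b) = (siegelIdeal K n (a + b)).comap (plane K n a b).subtype := by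
  ext ⟨θ, hθ⟩
  rw [LinearMap.mem_ker, Submodule.mem_comap, Submodule.subtype_apply, symP, LinearMap.comp_apply, Submodule.subtype_apply,
    AlgHom.toLinearMap_apply]
  constructor
  · intro h
    have hk : (⟨θ, plane_le_exteriorPower K a b hθ⟩ : ⋀[K]^(a + b) (In n → K)) ∈ LinearMap.ker (symk K n (a + b)) := by
      rw [LinearMap.mem_ker, symk, LinearMap.comp_apply, Submodule.subtype_apply, AlgHom.toLinearMap_apply]; exact h
    rw [ker_symk_eq_siegelIdeal] at hk
    exact hk
  · exact fun h => sym_eq_zero_of_mem_siegelIdeal K h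

/-- **THE ISOTROPIC PART OF EACH DOLBEAULT BLOCK: `dim (plane(a,b) ∩ SI_{a+b}) + C(n,a+b) = C(n,a)·C(n,b)`** for every field, `n`, `a`, `b`
(in the quoted dictionary: on `H^b(⋀^a T)` the forms no polynomial-in-`Θ` class can see have codimension exactly `C(n, a+b)`). -/
theorem finrank_plane_inf_siegelIdeal (a b : ℕ) :
    finrank K ↥(plane K n a b ⊓ siegelIdeal K n (a + b)) + n.choose (a + b) = n.choose a * n.choose b := by
  have h1 := LinearMap.finrank_range_add_finrank_ker (symP K n a b)
  rw [finrank_range_symP, ker_symP, finrank_plane] at h1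
  have h2 : finrank K ((siegelIdeal K n (a + b)).comap (plane K n a b).subtype) = finrank K ↥(plane K n a b ⊓ siegelIdeal K n (a + b)) := by
    rw [← Submodule.map_comap_subtype, Submodule.finrank_map_subtype_eq]
  omega

/-- **the PURE planes have no isotropic part: `plane(0,b) ∩ SI_b = 0`** (pure `y`-forms, `H^b(𝒪)`) … -/
theorem plane_zero_inf_siegelIdeal (b : ℕ) : plane K n 0 b ⊓ siegelIdeal K n b = ⊥ := by
  rw [← Submodule.finrank_eq_zero]
  have h := finrank_plane_inf_siegelIdeal K (n := n) 0 b
  rw [zero_add, Nat.choose_zero_right, one_mul] at h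
  omega

/-- … **and `plane(a,0) ∩ SI_a = 0`** (pure `x`-forms, `H^0(⋀^a T)`). -/
theorem plane_zero_inf_siegelIdeal' (a : ℕ) : plane K n a 0 ⊓ siegelIdeal K n a = ⊥ := by
  rw [← Submodule.finrank_eq_zero]
  have h := finrank_plane_inf_siegelIdeal K (n := n) a 0
  rw [add_zero, Nat.choose_zero_right, mul_one] at h
  omega

/-- the Siegel 2-vectors lie in the `(1,1)`-plane. -/
lemma sv_mem_plane {a c : ℕ} (ha : a < n) (hc : c < n) : sv K (n := n) a c ∈ plane K n 1 1 := by
  have key : ∀ (d e : ℕ) (hd : d < n) (he : e < n), X K n d * Y K n e ∈ plane K n 1 1 := by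
    intro d e hd he
    have h1 : X K n d = X K n ((⟨d, hd⟩ : Fin n) : ℕ) := rfl
    have h2 : Y K n e = Y K n ((⟨e, he⟩ : Fin n) : ℕ) := rfl
    rw [h1, h2, X_eq_gx, Y_eq_gx, gx_mul_gy]
    refine Submodule.smul_mem _ _ (Submodule.subset_span ⟨((⟨{⟨d, hd⟩}, rfl⟩, ⟨{⟨e, he⟩}, rfl⟩) : PIdx n 1 1), ?_⟩)
    show B K (In n) (xs {(⟨d, hd⟩ : Fin n)} ∪ ys {(⟨e, he⟩ : Fin n)}) = B K (In n) {Fin.castAdd n ⟨d, hd⟩, Fin.natAdd n ⟨e, he⟩}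
    rw [xs, ys, Finset.map_singleton, Finset.map_singleton, ← Finset.insert_eq]
    rfl
  unfold sv
  split_ifs with h
  · subst h; rw [add_zero]; exact key a a ha ha
  · exact Submodule.add_mem _ (key a c ha hc) (key c a hc ha)

/-- **ON `H¹(T)` THE ISOTROPIC PART IS EXACTLY THE SIEGEL SPACE: `plane(1,1) ∩ SI_2 = Siegel_n`** (dimension `n² − C(n,2) = n(n+1)/2`). -/
theorem plane_one_one_inf_siegelIdeal : plane K n 1 1 ⊓ siegelIdeal K n 2 = siegel K n := by
  symm
  apply Submodule.eq_of_le_of_finrank_eq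
  · rw [← siegelIdeal_two]
    refine le_inf ?_ le_rfl
    rw [siegelIdeal_two, siegel, Submodule.span_le]
    rintro _ ⟨p, rfl⟩
    exact sv_mem_plane K (SIdx_lt p).1 (SIdx_lt p).2
  · have h1 := finrank_plane_inf_siegelIdeal K (n := n) 1 1
    rw [Nat.choose_one_right, show (1 : ℕ) + 1 = 2 from rfl] at h1
    have h2 : 2 * finrank K (siegel K n) = n * n + n := by rw [two_mul_finrank_siegel]; ring
    have h3 : n * n = 2 * n.choose 2 + n := by
      have h : ((n * n : ℕ) : ℚ) = ((2 * n.choose 2 + n : ℕ) : ℚ) := by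
        push_cast [Nat.cast_choose_two]
        ring
      exact_mod_cast h
    generalize n * n = N at h1 h2 h3
    omega

/-! ### the powers `E_p` in the planes, and the VANISHING HALF of the per-block law -/

/-- the shift of the spike `δ_{p+1}` is `δ_p`. -/
lemma shift_spike_succ (p : ℕ) : shift K (fun j => if j = p + 1 then (1 : K) else 0) = fun j => if j = p then 1 else 0 := by
  funext j; simp [shift_apply]

/-- the shift of `δ_0` is the zero sequence. -/
lemma shift_spike_zero : shift K (fun j => if j = 0 then (1 : K) else 0) = fun _ => 0 := by
  funext j; simp [shift_apply]

/-- the class of the zero sequence vanishes. -/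
private lemma w_zero_seq (m : ℕ) : w K n m (fun _ => (0 : K)) = 0 := by
  induction m with
  | zero => simp [w]
  | succ m ih =>
    have hs : shift K (fun _ : ℕ => (0 : K)) = fun _ => 0 := funext fun _ => rfl
    rw [w, hs, ih, zero_mul, zero_mul, add_zero]

/-- `plane(a,b) · x_c ⊆ plane(a+1, b)`. -/
lemma mul_X_mem_plane {a b : ℕ} {θ : HT K (In n)} (hθ : θ ∈ plane K n a b) (c : Fin n) : θ * X K n c ∈ plane K n (a + 1) b := by
  rw [plane] at hθ
  induction hθ using Submodule.span_induction with
  | mem x hx =>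
    obtain ⟨⟨⟨P, hP⟩, ⟨Q, hQ⟩⟩, rfl⟩ := hx
    rw [pmon, X_eq_gx, gx, B_mul_B]
    by_cases hc : c ∈ P
    · rw [u_eq_zero K (by
        rw [Finset.disjoint_singleton_right, Finset.mem_union, not_or, castAdd_mem_xs]; exact fun h => h.1 hc), zero_smul]
      exact Submodule.zero_mem _
    · refine Submodule.smul_mem _ _ (Submodule.subset_span ⟨((⟨insert c P, by rw [Finset.card_insert_of_notMem hc, hP]⟩, ⟨Q, hQ⟩) : PIdx n (a + 1) b), ?_⟩)
      simp only [pmon]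
      rw [xs_insert, Finset.insert_union, Finset.union_comm _ {Fin.castAdd n c}, ← Finset.insert_eq]
  | zero => rw [zero_mul]; exact Submodule.zero_mem _
  | add x y _ _ hx hy => rw [add_mul]; exact Submodule.add_mem _ hx hy
  | smul d x _ hx => rw [smul_mul_assoc]; exact Submodule.smul_mem _ _ hx

/-- `plane(a,b) · y_c ⊆ plane(a, b+1)`. -/
lemma mul_Y_mem_plane {a b : ℕ} {θ : HT K (In n)} (hθ : θ ∈ plane K n a b) (c : Fin n) : θ * Y K n c ∈ plane K n a (b + 1) := by
  rw [plane] at hθ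
  induction hθ using Submodule.span_induction with
  | mem x hx =>
    obtain ⟨⟨⟨P, hP⟩, ⟨Q, hQ⟩⟩, rfl⟩ := hx
    rw [pmon, Y_eq_gx, gx, B_mul_B]
    by_cases hc : c ∈ Q
    · rw [u_eq_zero K (by
        rw [Finset.disjoint_singleton_right, Finset.mem_union, not_or, natAdd_mem_ys]; exact fun h => h.2 hc), zero_smul]
      exact Submodule.zero_mem _
    · refine Submodule.smul_mem _ _ (Submodule.subset_span ⟨((⟨P, hP⟩, ⟨insert c Q, by rw [Finset.card_insert_of_notMem hc, hQ]⟩) : PIdx n a (b + 1)), ?_⟩)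
      simp only [pmon]
      rw [ys_insert, Finset.union_insert, Finset.union_comm _ {Fin.natAdd n c}, ← Finset.insert_eq]
  | zero => rw [zero_mul]; exact Submodule.zero_mem _
  | add x y _ _ hx hy => rw [add_mul]; exact Submodule.add_mem _ hx hy
  | smul d x _ hx => rw [smul_mul_assoc]; exact Submodule.smul_mem _ _ hx

/-- **`E_p` LIVES IN THE `(m−p, p)`-PLANE: `w_m(δ_p) ∈ plane(m − p, p)`** for `p ≤ m ≤ n` (th-7's recursion adds one `x` or one `y` per pair). -/
theorem w_spike_mem_plane {m : ℕ} (hm : m ≤ n) {p : ℕ} (hp : p ≤ m) :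
    w K n m (fun j => if j = p then (1 : K) else 0) ∈ plane K n (m - p) p := by
  induction m generalizing p with
  | zero =>
    obtain rfl : p = 0 := by omega
    rw [w, if_pos rfl, one_smul]
    have : (1 : HT K (In n)) = pmon K ((⟨∅, rfl⟩, ⟨∅, rfl⟩) : PIdx n 0 0) := by
      rw [pmon]; simp only [xs, ys, Finset.map_empty, Finset.union_empty]; exact (B_empty K).symm
    rw [this]; exact Submodule.subset_span ⟨_, rfl⟩
  | succ m ih =>
    have hmn : m < n := by omega
    rw [w]
    refine Submodule.add_mem _ ?_ ?_
    · rcases Nat.lt_or_ge m p with hpm | hpm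
      · -- p = m + 1: w_m(δ_{m+1}) = 0
        obtain rfl : p = m + 1 := by omega
        have h0 : w K n m (fun j => if j = m + 1 then (1 : K) else 0) = 0 := by
          have key : ∀ (m' : ℕ), m' ≤ m → ∀ p', m' < p' → w K n m' (fun j => if j = p' then (1 : K) else 0) = 0 := by
            intro m'
            induction m' with
            | zero => intro _ p' hp'; rw [w, if_neg (by omega), zero_smul]
            | succ m' ih' =>
              intro hm' p' hp'
              obtain ⟨p'', rfl⟩ : ∃ p'', p' = p'' + 1 := ⟨p' - 1, by omega⟩
              rw [w, shift_spike_succ, ih' (by omega) (p'' + 1) (by omega), ih' (by omega) p'' (by omega), zero_mul, zero_mul, add_zero]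
          exact key m le_rfl (m + 1) (by omega)
        rw [h0, zero_mul]; exact Submodule.zero_mem _
      · have h := mul_X_mem_plane K (ih (by omega) hpm) ⟨m, hmn⟩
        have e : m - p + 1 = m + 1 - p := by omega
        rw [e] at h; exact h
    · rcases Nat.eq_zero_or_pos p with rfl | hp0
      · rw [shift_spike_zero, w_zero_seq, zero_mul]; exact Submodule.zero_mem _
      · obtain ⟨p', rfl⟩ : ∃ p', p = p' + 1 := ⟨p - 1, by omega⟩
        rw [shift_spike_succ]
        have h := mul_Y_mem_plane K (ih (by omega) (p := p') (by omega)) ⟨m, hmn⟩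
        have e : m - p' = m + 1 - (p' + 1) := by omega
        rw [e] at h; exact h

/-- plane monomials with too many `x`- or `y`-letters between them multiply to zero. -/
lemma pmon_mul_pmon_eq_zero {a b a' b' : ℕ} (h : n < a + a' ∨ n < b + b') (i : PIdx n a b) (j : PIdx n a' b') :
    pmon K i * pmon K j = 0 := by
  obtain ⟨⟨P, hP⟩, ⟨Q, hQ⟩⟩ := i
  obtain ⟨⟨P', hP'⟩, ⟨Q', hQ'⟩⟩ := j
  rw [pmon, pmon, B_mul_B, u_eq_zero, zero_smul]
  intro hd
  rcases h with h | h
  · have hPP : Disjoint P P' := by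
      rw [Finset.disjoint_left]; intro c hc hc'
      exact Finset.disjoint_left.mp hd (Finset.mem_union_left _ (castAdd_mem_xs.mpr hc)) (Finset.mem_union_left _ (castAdd_mem_xs.mpr hc'))
    have := Finset.card_le_univ (P ∪ P')
    rw [Finset.card_union_of_disjoint hPP, Fintype.card_fin, hP, hP'] at this
    omega
  · have hQQ : Disjoint Q Q' := by
      rw [Finset.disjoint_left]; intro c hc hc'
      exact Finset.disjoint_left.mp hd (Finset.mem_union_right _ (natAdd_mem_ys.mpr hc)) (Finset.mem_union_right _ (natAdd_mem_ys.mpr hc'))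
    have := Finset.card_le_univ (Q ∪ Q')
    rw [Finset.card_union_of_disjoint hQQ, Fintype.card_fin, hQ, hQ'] at this
    omega

/-- **planes with more than `n` `x`-letters or more than `n` `y`-letters between them multiply to zero.** -/
theorem mul_eq_zero_of_mem_plane {a b a' b' : ℕ} (h : n < a + a' ∨ n < b + b') {θ η : HT K (In n)}
    (hθ : θ ∈ plane K n a b) (hη : η ∈ plane K n a' b') : θ * η = 0 := by
  rw [plane] at hθ hη
  induction hθ, hη using Submodule.span_induction₂ with
  | mem_mem x y hx hy =>
    obtain ⟨i, rfl⟩ := hx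
    obtain ⟨j, rfl⟩ := hy
    exact pmon_mul_pmon_eq_zero K h i j
  | zero_left y _ => rw [zero_mul]
  | zero_right x _ => rw [mul_zero]
  | add_left x y z _ _ _ hx hy => rw [add_mul, hx, hy, add_zero]
  | add_right x y z _ _ _ hx hy => rw [mul_add, hx, hy, add_zero]
  | smul_left r x y _ _ hx => rw [smul_mul_assoc, hx, smul_zero]
  | smul_right r x y _ _ hx => rw [mul_smul_comm, hx, smul_zero]


end Summit.Ventures.HSemireg.Wedge.HankelSiegelIdeal
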